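import Summits.QuantumFields.BalabanUV.Gaps.EndRunwiseCone
import Summits.QuantumFields.BalabanUV.Gaps.WeakestBetaCurrency

/-!
# Gaps / EndRunwiseWitness — ONE toy family on which the CONE ∕ RUN-WISE roads deliver Theorem 2 AS PRINTED while every BOX currency of
# the lane is EMPTY (no sign on any box, no (PS) on any box, no W-β certificate)
# (cell pub-balaban-gaps, seat g1-p3 gen 6, row CAP+tail ∕ β-currency «split ∕ weakening»; definition-lane companion of `Gaps/EndRunwiseShooting`
# ∕ `Gaps/EndRunwiseCone`)

HONEST FRAMING (cell rule, page 1 of everything): an explicit [folklore] toy family of history-dependent β-functions and elementary real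
analysis on it; `B12.Thm2Printed` ∕ `EndpointExistence` hold for ITS canonical construction `FlowStepRuns.modelOf` (and every construction
generated forward by (0.20) with it) — statements about the TOY, not about Bałaban's β-functions; [I] Thm 2 is UNPROVED in print.
NOTHING of Bałaban's is asserted; 0∕6 binders; 0 coefficients certified; one finite T⁴; NOT B12 Thm 2, NOT `BetaPertH`, NOT continuum, NOT Clay.

THE FAMILY.  `betaZig c k v = 1 − c · drop k v`, `drop k v = Σ_{i<k} (v_i − v_{i+1})⁺` (the accumulated DOWNWARD variation of the history):
`β = 1` on every NON-DECREASING history (so on the running cone, and along every run — the runs are the constant-step flows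
`1∕g_{k+1}² = 1∕g_k² − 1`), `β ≤ 1` everywhere, jointly continuous; but along the zigzag history `γ, γ∕2, γ, γ∕2, …` the drop grows without
bound, so `β_{2m+1}(zigzag) = 1 − c m γ∕2 → −∞` on EVERY box `]0,γ]`, `c > 0`.
CONSEQUENCES (kernel): (i) `thm2Printed_of_forwardGenerated_betaZig` — [I] Thm 2's printed shape, incl. (0.31) with `b = β′ = 1`, for every
construction generated forward by (0.20) with `betaZig c` (`c ≥ 0`), every `L > 1`, via `EndRunwiseCone.thm2Printed_of_coneBoundsH`;
(ii) `not_betaLowerH_betaZig` — no sign on any box; (iii) `not_betaPartialSumsLowerH_betaZig` — no (PS) on any box, for any defect `M`;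
(iv) `isEmpty_wBeta_betaZig` — the W-β carrier of `Gaps/WeakestBetaCurrency` (the weakest certificate currency THE TREE turned into `hEnd`
before this gen: CAP+tail → Floor → Drift → W-β) is EMPTY.  So the cone ∕ run-wise road of this gen reaches data that NO box road of the
tree reaches — not only at END grade (g1-plan-2's S-33 model, not in the tree, has END without W-β) but at the grade of Theorem 2 as printed.
What this does NOT show: that run-wise (PS) is necessary for END (it is not — g1-plan-2's AF-1 model kernel `XreadEndWindowModel_plan2` §12,
NOT a tree file, has END with unbounded run-wise drawdowns at every level); nothing about Bałaban's β.
4 def (toy data: `drop`, `betaZig`, `zig`, `zigStep`); 0 sorry; imports `Gaps/EndRunwiseCone`, `Gaps/WeakestBetaCurrency` only.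

CITATION HEADER (tags CONTEXT ONLY).  [I] = T. Bałaban, Commun. Math. Phys. **109** (1987) [Balaban1987RG1]: Thm 2 ∕ (0.31) p. 259, (0.20)
p. 256, §5 p. 298 (history dependence of β).
-/

namespace Summit.QuantumFields.BalabanUV.Gaps.EndRunwiseWitness

open Literature.MathematicalPhysics.QuantumFieldTheory.Balaban1983to89
open Literature.MathematicalPhysics.QuantumFieldTheory.Balaban1983to89.FlowStep
open Literature.MathematicalPhysics.QuantumFieldTheory.Balaban1983to89.FlowStepRuns
open Literature.MathematicalPhysics.QuantumFieldTheory.Balaban1983to89.DagBinding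
open Summit.QuantumFields.BalabanUV.Gaps.EndRunwiseShooting
open Summit.QuantumFields.BalabanUV.Gaps.EndRunwiseCone
open Summit.QuantumFields.BalabanUV.Gaps.WeakestBetaCurrency (WBeta)
open Finset

noncomputable section

/-! ## §1 The family and its elementary properties -/

/-- The accumulated DOWNWARD variation of a history `v = (v_0,…,v_k)`: `Σ_{i<k} (v_i − v_{i+1})⁺`. [folklore] -/
def drop (k : ℕ) (v : Fin (k + 1) → ℝ) : ℝ := ∑ i : Fin k, max (v i.castSucc - v i.succ) 0

/-- THE ZIGZAG-PENALTY FAMILY `β_{k+1}(v) = 1 − c · drop(v)`: equal to `1` on non-decreasing histories, punishing every descent. [folklore] -/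
def betaZig (c : ℝ) : HBeta := fun k v => 1 - c * drop k v

/-- `drop ≥ 0`. [folklore] -/
theorem drop_nonneg (k : ℕ) (v : Fin (k + 1) → ℝ) : 0 ≤ drop k v :=
  Finset.sum_nonneg fun _ _ => le_max_right _ _

/-- `betaZig c ≤ 1` everywhere for `c ≥ 0`; in particular `BetaUpperH 1 γ (betaZig c)` on every box. [folklore] -/
theorem betaZig_upper {c : ℝ} (hc : 0 ≤ c) (γ : ℝ) : BetaUpperH 1 γ (betaZig c) := by
  intro k v _
  show 1 - c * drop k v ≤ 1
  nlinarith [drop_nonneg k v]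

/-- `drop` is continuous in the history. [folklore] -/
theorem continuous_drop (k : ℕ) : Continuous (drop k) := by
  unfold drop
  refine continuous_finsetSum _ fun i _ => ?_
  exact ((continuous_apply i.castSucc).sub (continuous_apply i.succ)).max continuous_const

/-- `betaZig c` is jointly continuous on every box. [folklore] -/
theorem betaZig_cont (c γ : ℝ) : BetaContH γ (betaZig c) := fun k =>
  (continuous_const.sub (continuous_const.mul (continuous_drop k))).continuousOn

/-- On a NON-DECREASING history the drop vanishes. [folklore] -/
theorem drop_eq_zero_of_monotone {k : ℕ} {gs : ℕ → ℝ} (hmono : ∀ i j, i ≤ j → j ≤ k → gs i ≤ gs j) :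
    drop k (prefixOf gs k) = 0 := by
  refine Finset.sum_eq_zero fun i _ => ?_
  have h : gs i ≤ gs (i + 1) := hmono i (i + 1) (Nat.le_succ _) (by have := i.isLt; omega)
  show max (gs (Fin.castSucc i) - gs (Fin.succ i)) 0 = 0
  rw [Fin.val_castSucc, Fin.val_succ]
  exact max_eq_right (by linarith)

/-- Hence `betaZig c = 1` on non-decreasing histories. [folklore] -/
theorem betaZig_eq_one_of_monotone (c : ℝ) {k : ℕ} {gs : ℕ → ℝ} (hmono : ∀ i j, i ≤ j → j ≤ k → gs i ≤ gs j) :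
    betaZig c k (prefixOf gs k) = 1 := by
  show 1 - c * drop k (prefixOf gs k) = 1
  rw [drop_eq_zero_of_monotone hmono]; ring

/-- A history in the `b = 0` running cone (`0 ≤ 1∕g_j² − 1∕g_{j+1}²`, positive couplings) is non-decreasing. [folklore] -/
theorem monotone_of_runningCone {k : ℕ} {gs : ℕ → ℝ} {γ β' : ℝ} (hgs : ∀ i, i ≤ k → 0 < gs i ∧ gs i ≤ γ)
    (hrun : ∀ j, j < k → 0 ≤ 1 / (gs j) ^ 2 - 1 / (gs (j + 1)) ^ 2 ∧ 1 / (gs j) ^ 2 - 1 / (gs (j + 1)) ^ 2 ≤ β') :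
    ∀ i j, i ≤ j → j ≤ k → gs i ≤ gs j := by
  have hstep : ∀ j, j < k → gs j ≤ gs (j + 1) := by
    intro j hj
    have h1 : 1 / (gs (j + 1)) ^ 2 ≤ 1 / (gs j) ^ 2 := by linarith [(hrun j hj).1]
    have hp : 0 < gs (j + 1) := (hgs (j + 1) hj).1
    have hq : 0 < gs j := (hgs j hj.le).1
    have h2 : (gs j) ^ 2 ≤ (gs (j + 1)) ^ 2 := by rwa [one_div_le_one_div (by positivity) (by positivity)] at h1
    nlinarith
  intro i j hij hjk
  induction j, hij using Nat.le_induction with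
  | base => exact le_rfl
  | succ j hij ih => exact (ih (Nat.le_of_succ_le hjk)).trans (hstep j (Nat.lt_of_succ_le hjk))

/-- CONE BOUNDS for the family with `b = β′ = 1`, at every level `γ`, for every `c` (the premise of the running cone with `b = 1 ≥ 0` makes the
history non-decreasing, where `β = 1`). [folklore] -/
theorem coneBounds_betaZig (c γ : ℝ) :
    ∀ (k : ℕ) (gs : ℕ → ℝ), (∀ i, i ≤ k → 0 < gs i ∧ gs i ≤ γ) →
      (∀ j, j < k → (1 : ℝ) ≤ 1 / (gs j) ^ 2 - 1 / (gs (j + 1)) ^ 2 ∧ 1 / (gs j) ^ 2 - 1 / (gs (j + 1)) ^ 2 ≤ 1) →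
      (1 : ℝ) ≤ betaZig c k (prefixOf gs k) ∧ betaZig c k (prefixOf gs k) ≤ 1 := by
  intro k gs hgs hrun
  have hmono := monotone_of_runningCone (β' := 1) hgs fun j hj => ⟨zero_le_one.trans (hrun j hj).1, (hrun j hj).2⟩
  rw [betaZig_eq_one_of_monotone c hmono]
  exact ⟨le_rfl, le_rfl⟩

/-! ## §2 POSITIVE: Theorem 2 AS PRINTED and the END binder for the family, by the cone road -/

/-- **[I] THEOREM 2's PRINTED SHAPE FOR THE FAMILY**: for every construction generated forward by (0.20) with `betaZig c` (any real `c`) and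
every `L > 1`, `B12.Thm2Printed C L` — by `EndRunwiseCone.thm2Printed_of_coneBoundsH` with `γ₀ = 1`, `b = β′ = 1`.  A statement about the TOY
family (Theorem 2 itself is unproved in print). [folklore] -/
theorem thm2Printed_of_forwardGenerated_betaZig (c : ℝ) {C : B12.Construction} (hgen : ForwardGenerated C (betaZig c)) {L : ℝ}
    (hL : 1 < L) : B12.Thm2Printed C L :=
  thm2Printed_of_coneBoundsH hgen hL one_pos one_pos le_rfl (betaZig_cont c 1) (coneBounds_betaZig c 1)

/-- In particular for the canonical construction `modelOf (betaZig c)`. [folklore] -/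
theorem thm2Printed_modelOf_betaZig (c : ℝ) {L : ℝ} (hL : 1 < L) : B12.Thm2Printed (modelOf (betaZig c)) L :=
  thm2Printed_of_forwardGenerated_betaZig c (modelOf_forwardGenerated _) hL

/-- … and the END binder `EndpointExistence` (with `g⋆ = γ`), by `EndRunwiseCone.endpointExistence_of_coneSign`. [folklore] -/
theorem endpointExistence_of_forwardGenerated_betaZig (c : ℝ) {C : B12.Construction} (hgen : ForwardGenerated C (betaZig c)) :
    EndpointExistence C :=
  endpointExistence_of_coneSign hgen one_pos zero_le_one (betaZig_cont c 1) fun k gs hgs hrun => by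
    have hmono := monotone_of_runningCone hgs hrun
    rw [betaZig_eq_one_of_monotone c hmono]
    exact ⟨zero_le_one, le_rfl⟩

/-! ## §3 NEGATIVE: no sign, no (PS), no W-β certificate on any box (`c > 0`) -/

/-- The zigzag history `γ, γ∕2, γ, γ∕2, …`. [folklore] -/
def zig (γ : ℝ) : ℕ → ℝ := fun i => if Even i then γ else γ / 2

/-- Its one-step drops: `(zig_i − zig_{i+1})⁺`. [folklore] -/
def zigStep (γ : ℝ) (i : ℕ) : ℝ := max (zig γ i - zig γ (i + 1)) 0

/-- The zigzag history lies in the box `]0,γ]` (`γ > 0`). [folklore] -/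
theorem zig_mem {γ : ℝ} (hγ : 0 < γ) (i : ℕ) : 0 < zig γ i ∧ zig γ i ≤ γ := by
  unfold zig; split_ifs
  · exact ⟨hγ, le_rfl⟩
  · exact ⟨by positivity, by linarith⟩

/-- An even step drops by `γ∕2` (`γ ≥ 0`). [folklore] -/
theorem zigStep_even {γ : ℝ} (hγ : 0 ≤ γ) {i : ℕ} (hi : Even i) : zigStep γ i = γ / 2 := by
  have hi' : ¬ Even (i + 1) := fun h => (Nat.even_add_one.mp h) hi
  unfold zigStep zig
  rw [if_pos hi, if_neg hi', max_eq_left (by linarith)]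
  ring

/-- An odd step does not drop. [folklore] -/
theorem zigStep_odd {γ : ℝ} (hγ : 0 ≤ γ) {i : ℕ} (hi : ¬ Even i) : zigStep γ i = 0 := by
  have hi' : Even (i + 1) := Nat.even_add_one.mpr hi
  unfold zigStep zig
  rw [if_neg hi, if_pos hi']
  exact max_eq_right (by linarith)

/-- The drop of the zigzag prefix of length `k + 1` is the sum of its one-step drops. [folklore] -/
theorem drop_zig (γ : ℝ) (k : ℕ) : drop k (prefixOf (zig γ) k) = ∑ i ∈ Finset.range k, zigStep γ i := by
  unfold drop
  rw [← Fin.sum_univ_eq_sum_range (zigStep γ) k]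
  refine Finset.sum_congr rfl fun i _ => ?_
  simp [zigStep, prefixOf, Fin.val_succ]

/-- After `2m` steps the zigzag has dropped by `m · γ∕2` in total. [folklore] -/
theorem drop_zig_two_mul {γ : ℝ} (hγ : 0 ≤ γ) (m : ℕ) : drop (2 * m) (prefixOf (zig γ) (2 * m)) = m * (γ / 2) := by
  rw [drop_zig]
  induction m with
  | zero => simp
  | succ m ih =>
    rw [show 2 * (m + 1) = 2 * m + 1 + 1 by ring, Finset.sum_range_succ, Finset.sum_range_succ, ih,
      zigStep_even hγ (even_two_mul m), zigStep_odd hγ (by rw [Nat.not_even_iff_odd]; exact odd_two_mul_add_one m)]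
    push_cast; ring

/-- Hence `β_{2m+1}(zigzag) = 1 − c m γ∕2`. [folklore] -/
theorem betaZig_zig_two_mul {γ : ℝ} (hγ : 0 ≤ γ) (c : ℝ) (m : ℕ) :
    betaZig c (2 * m) (prefixOf (zig γ) (2 * m)) = 1 - c * (m * (γ / 2)) := by
  show 1 - c * drop (2 * m) (prefixOf (zig γ) (2 * m)) = _
  rw [drop_zig_two_mul hγ m]

/-- … which is below any prescribed level `−A` for `m` large: with `m = ⌈2(A+1)∕(cγ)⌉₊`, `β_{2m+1}(zigzag) ≤ −A` (`c, γ > 0`). [folklore] -/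
theorem betaZig_zig_le {γ c : ℝ} (hγ : 0 < γ) (hc : 0 < c) (A : ℝ) :
    ∃ m : ℕ, betaZig c (2 * m) (prefixOf (zig γ) (2 * m)) ≤ -A := by
  refine ⟨⌈2 * (A + 1) / (c * γ)⌉₊, ?_⟩
  rw [betaZig_zig_two_mul hγ.le]
  have hcγ : 0 < c * γ := mul_pos hc hγ
  have hm : 2 * (A + 1) / (c * γ) ≤ (⌈2 * (A + 1) / (c * γ)⌉₊ : ℝ) := Nat.le_ceil _
  have h1 : 2 * (A + 1) ≤ (⌈2 * (A + 1) / (c * γ)⌉₊ : ℝ) * (c * γ) := by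
    by_cases hA : 0 ≤ 2 * (A + 1)
    · rwa [div_le_iff₀ hcγ] at hm
    · push Not at hA
      nlinarith [Nat.cast_nonneg (α := ℝ) ⌈2 * (A + 1) / (c * γ)⌉₊]
  nlinarith

/-- **NO SIGN ON ANY BOX**: `¬ BetaLowerH 0 γ (betaZig c)` for every `γ > 0`, `c > 0` (the zigzag prefix of length `2m+1` is in the box and
`β` is `≤ −1` there). [folklore] -/
theorem not_betaLowerH_betaZig {γ c : ℝ} (hγ : 0 < γ) (hc : 0 < c) : ¬ BetaLowerH 0 γ (betaZig c) := by
  intro h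
  obtain ⟨m, hm⟩ := betaZig_zig_le hγ hc 1
  have := h (2 * m) (prefixOf (zig γ) (2 * m)) (mem_box.mpr fun i => zig_mem hγ i)
  linarith

/-- **NO (PS) ON ANY BOX, FOR ANY DEFECT**: `¬ FlowStepRuns.BetaPartialSumsLowerH M γ (betaZig c)` (`γ > 0`, `c > 0`, every `M`) — already the
ONE-TERM windows `[2m, 2m+1)` along the zigzag history are unbounded below. [folklore] -/
theorem not_betaPartialSumsLowerH_betaZig {γ c : ℝ} (hγ : 0 < γ) (hc : 0 < c) (M : ℝ) :
    ¬ BetaPartialSumsLowerH M γ (betaZig c) := by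
  intro h
  obtain ⟨m, hm⟩ := betaZig_zig_le hγ hc (M + 1)
  have := h (zig γ) (zig_mem hγ) (2 * m) (2 * m + 1) (Nat.le_succ _)
  rw [Finset.sum_Ico_succ_top le_rfl, Finset.Ico_self, Finset.sum_empty, zero_add] at this
  linarith

/-- **THE W-β CARRIER IS EMPTY** for the family (`c > 0`): no triple (box, defect, ceiling) certifies `betaZig c` in the weakest box currency
`Gaps.WeakestBetaCurrency.WBeta` the tree turned into `hEnd` — so NO road through Floor ⟹ Drift ⟹ W-β (rows CAP+tail, (D1)+(D4) in box form) can
reach this datum, while the cone road gives it Theorem 2's printed shape (`thm2Printed_of_forwardGenerated_betaZig`). [folklore] -/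
theorem isEmpty_wBeta_betaZig {c : ℝ} (hc : 0 < c) : IsEmpty (WBeta (betaZig c)) :=
  ⟨fun W => not_betaPartialSumsLowerH_betaZig W.γ₀_pos hc W.M W.ps⟩

/-- SUMMARY SEPARATION (one line): a β-family with NO W-β certificate and NO sign on any box whose every forward-generated construction
nevertheless satisfies [I] Theorem 2's printed shape for every `L > 1` — the cone ∕ run-wise road of `EndRunwiseShooting` ∕ `EndRunwiseCone` is
STRICTLY wider than every box road of the tree, at Theorem-2 grade. [folklore] -/
theorem cone_road_strictly_wider {c : ℝ} (hc : 0 < c) :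
    IsEmpty (WBeta (betaZig c)) ∧ (∀ γ : ℝ, 0 < γ → ¬ BetaLowerH 0 γ (betaZig c)) ∧
      ∀ (C : B12.Construction), ForwardGenerated C (betaZig c) → ∀ L : ℝ, 1 < L → B12.Thm2Printed C L :=
  ⟨isEmpty_wBeta_betaZig hc, fun _ hγ => not_betaLowerH_betaZig hγ hc,
    fun _ hgen _ hL => thm2Printed_of_forwardGenerated_betaZig c hgen hL⟩

end

end Summit.QuantumFields.BalabanUV.Gaps.EndRunwiseWitness
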